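import Literature.Probability.LatticeModels.CoarseCellMixingDefectsClusterTerm
import Literature.Probability.LatticeModels.CoarseCellMixingDefectsFarChains
import Literature.Probability.LatticeModels.CoarseCellMixingDefectsSteps
import HarnessLib

/-!
# Coarse-cell mixing with defects: the cube step of the block recursion (block-Markov case)

Companion ("theorems only") file of the coarse-cell defect series. One step of the
Dobrushin–Shlosman block recursion with Peierls-rare defects, for a block-Markov specification
(`HasBlockLeak cell γ 0 r`) with the good-exterior finite-size condition `IsGoodFS cell γ good n ε`
and the kernel-uniform Peierls bound at level `q`: the influence of an `F`-admissible boundary pair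
on a `[0,1]`-valued observable `g` of a cell `x` at coarse distance `≥ D ≥ 2n+3` from `F` is
bounded by

`ε Σ_{y ∈ Y} δ y + Σ_{K near, K ≠ ∅} 2 q^{|K|} Σ_{y ∈ R_K} δ y + 2 |Y| · 2q ((3^d+1)^2 q)^{D-2n-3}`

(`cubeStep_influence_le`), where `Y` are the volume cells at coarse distance exactly `2n+1` from
`x` (the shell), `δ` is any single-cell influence bound valid for `F`-admissible pairs in every
volume, the near cluster shapes `K` are the nonempty cluster shapes for the seed `Y` inside the
ball of radius `D - 2`, and `R_K` is the ring of `cube ∪ K`. Mechanism: resample the cube (glued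
inner expectation `h`, a `[0,1]`-valued observable of the shell by block-Markovness); on the event
that the shell is good, `h` oscillates by at most `ε` (finite-size condition) — the vanishing chain
rule `multiCell_influence_adm`; off it, decompose by the bad cluster attached to the shell: near
shapes by `clusterTerm_influence_le`, far ones by `measureReal_farEvent_le`.

## References

* R. L. Dobrushin, S. B. Shlosman (1985), §2; J. van den Berg, C. Maes, Ann. Probab. 22 (1994), §2;
  H.-O. Georgii, *Gibbs Measures and Phase Transitions* (2011), §8.2.
-/

noncomputable section

open _root_.MeasureTheory
open scoped ENNReal

namespace Literature.Probability.LatticeModels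

variable {d : ℕ} {μc : Fin d → ℕ} {V S : Type*} [MeasurableSpace S]

/-- **The cube step of the block recursion with defects (block-Markov case).** See the module
docstring. The three terms are: the finite-size contraction over the shell `Y`, the near bad
clusters attached to the shell (each resampled together with the cube), and the far clusters.
[folklore] -/
theorem cubeStep_influence_le [Fintype V] [DecidableEq V] {cell : V → CoarseIdx μc}
    {γ : Specification V S} (hγ : IsSpecification γ) {good : CoarseIdx μc → Set (V → S)}
    (hgl : ∀ (c : CoarseIdx μc) (σ τ : V → S), (∀ v, cell v = c → σ v = τ v) →
      (σ ∈ good c ↔ τ ∈ good c))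
    (hgm : ∀ c, MeasurableSet (good c)) {n : ℕ} {ε : ℝ} (hε : 0 ≤ ε)
    (hFS : IsGoodFS cell γ good n ε) {r : ℝ} (hBL : HasBlockLeak cell γ 0 r)
    {q : ℝ} (hq : 0 ≤ q) (hq2 : ((3 : ℝ) ^ d + 1) ^ 2 * q ≤ 1 / 2) (hq1 : q < 1)
    (hUKP : UniformKernelPeierls cell γ good q)
    (F : Finset (CoarseIdx μc)) (x : CoarseIdx μc) {D : ℕ} (hD : 2 * n + 3 ≤ D)
    (hxF : ∀ f ∈ F, D ≤ cdist x f)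
    {δ : CoarseIdx μc → ℝ} (hδ : ∀ y, 0 ≤ δ y)
    (hR : ∀ (Λ : Finset V), (∀ v w, cell v = cell w → v ∈ Λ → w ∈ Λ) →
      ∀ (y : CoarseIdx μc) (g : (V → S) → ℝ), Measurable g → (∀ σ, 0 ≤ g σ ∧ g σ ≤ 1) →
      DependsOn g {v | cell v = y} →
      ∀ ζ ζ' : V → S, AdmRegion cell good F Λ ζ ζ' →
        |∫ σ, g σ ∂(γ Λ ζ) - ∫ σ, g σ ∂(γ Λ ζ')| ≤ δ y)
    (Λ' : Finset V) (hΛ' : ∀ v w, cell v = cell w → v ∈ Λ' → w ∈ Λ')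
    (ζ ζ' : V → S) (hadm : AdmRegion cell good F Λ' ζ ζ')
    (g : (V → S) → ℝ) (hgm' : Measurable g) (hg01 : ∀ σ, 0 ≤ g σ ∧ g σ ≤ 1)
    (hgdep : DependsOn g {v | cell v = x}) :
    |∫ σ, g σ ∂(γ Λ' ζ) - ∫ σ, g σ ∂(γ Λ' ζ')| ≤
      ε * ∑ y ∈ (Finset.univ.filter fun c : CoarseIdx μc => cdist x c = 2 * n + 1).filter
          (fun c => ∀ v, cell v = c → v ∈ Λ'), δ y +
      ∑ K ∈ (clusterShapes 1 Finset.univ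
            ((Finset.univ.filter fun c : CoarseIdx μc => cdist x c = 2 * n + 1).filter
              (fun c => ∀ v, cell v = c → v ∈ Λ'))).filter
          (fun K => K.Nonempty ∧ K ⊆ Finset.univ.filter fun c : CoarseIdx μc => cdist x c ≤ D - 2),
        2 * q ^ K.card *
          ∑ y ∈ ((((Finset.univ.filter fun c : CoarseIdx μc => cdist x c = 2 * n + 1).filter
                (fun c => ∀ v, cell v = c → v ∈ Λ')) ∪
              fatten Finset.univ ((Finset.univ.filter fun c : CoarseIdx μc => cdist x c ≤ 2 * n) ∪ K)
                1) \ ((Finset.univ.filter fun c : CoarseIdx μc => cdist x c ≤ 2 * n) ∪ K)).filter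
              (fun c => ∀ v, cell v = c → v ∈ Λ'), δ y +
      2 * (((Finset.univ.filter fun c : CoarseIdx μc => cdist x c = 2 * n + 1).filter
            (fun c => ∀ v, cell v = c → v ∈ Λ')).card *
          (2 * q * (((3 : ℝ) ^ d + 1) ^ 2 * q) ^ (D - 2 * n - 3))) := by
  classical
  -- notation
  set Q : Finset (CoarseIdx μc) := Finset.univ.filter fun c : CoarseIdx μc => cdist x c ≤ 2 * n
    with hQdef
  set Y : Finset (CoarseIdx μc) := (Finset.univ.filter fun c : CoarseIdx μc =>
    cdist x c = 2 * n + 1).filter (fun c => ∀ v, cell v = c → v ∈ Λ') with hYdef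
  set U : Finset (CoarseIdx μc) := Finset.univ.filter fun c : CoarseIdx μc => cdist x c ≤ D - 2
    with hUdef
  set 𝒩 := (clusterShapes 1 Finset.univ Y).filter (fun K => K.Nonempty ∧ K ⊆ U) with h𝒩def
  set Rg : Finset (CoarseIdx μc) → Finset (CoarseIdx μc) := fun K =>
    ((Y ∪ fatten Finset.univ (Q ∪ K) 1) \ (Q ∪ K)).filter (fun c => ∀ v, cell v = c → v ∈ Λ')
    with hRgdef
  have hmemQ : ∀ c, c ∈ Q ↔ cdist x c ≤ 2 * n := fun c => by simp [hQdef]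
  have hmemY : ∀ c, c ∈ Y ↔ cdist x c = 2 * n + 1 ∧ ∀ v, cell v = c → v ∈ Λ' := fun c => by
    simp [hYdef]
  have hmemU : ∀ c, c ∈ U ↔ cdist x c ≤ D - 2 := fun c => by simp [hUdef]
  haveI := hγ.isProbability Λ' ζ
  haveI := hγ.isProbability Λ' ζ'
  have hRHS0 : 0 ≤ ε * ∑ y ∈ Y, δ y + ∑ K ∈ 𝒩, 2 * q ^ K.card * ∑ y ∈ Rg K, δ y +
      2 * (Y.card * (2 * q * (((3 : ℝ) ^ d + 1) ^ 2 * q) ^ (D - 2 * n - 3))) := by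
    have h1 : 0 ≤ ∑ y ∈ Y, δ y := Finset.sum_nonneg fun y _ => hδ y
    have h2 : 0 ≤ ∑ K ∈ 𝒩, 2 * q ^ K.card * ∑ y ∈ Rg K, δ y :=
      Finset.sum_nonneg fun K _ => mul_nonneg (by positivity) (Finset.sum_nonneg fun y _ => hδ y)
    positivity
  -- frozen cells within distance `D - 1` of `x` are off the sources, hence agree and are good
  have hoffF : ∀ c : CoarseIdx μc, cdist x c ≤ D - 1 → c ∉ F := fun c hc hcF => by
    have := hxF c hcF; omega
  -- Case 1: the cell `x` is frozen — then the influence vanishes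
  by_cases hxΛ : ∀ v, cell v = x → v ∈ Λ'
  swap
  · push Not at hxΛ
    obtain ⟨v₀, hv₀x, hv₀⟩ := hxΛ
    have hxout : ∀ v, cell v = x → v ∉ Λ' := fun v hv hvΛ => hv₀ (hΛ' v v₀ (hv.trans hv₀x.symm) hvΛ)
    have hxF' : x ∉ F := hoffF x (by rw [cdist_self]; exact Nat.zero_le _)
    have hconst : ∀ η : V → S, (∀ v, v ∉ Λ' → cell v ∉ F → η v = ζ v) →
        ∫ σ, g σ ∂(γ Λ' η) = g ζ := by
      intro η hη
      haveI := hγ.isProbability Λ' η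
      have h : ∀ᵐ σ ∂(γ Λ' η), g σ = g ζ := by
        filter_upwards [hγ.proper Λ' η] with σ hσ
        exact hgdep fun v hv => by
          have hv' : cell v = x := hv
          rw [hσ v (hxout v hv'), hη v (hxout v hv') (hv'.symm ▸ hxF')]
      rw [integral_congr_ae h, integral_const, probReal_univ, smul_eq_mul, one_mul]
    rw [hconst ζ (fun _ _ _ => rfl), hconst ζ' (fun v hv hF => (hadm v hv hF).1.symm), sub_self,
      abs_zero]
    exact hRHS0
  -- Case 2: `x` is a volume cell
  -- the glued configurations
  let glue : (V → S) → (V → S) := fun σ v => if v ∈ Λ' then σ v else ζ v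
  have hglue_m : Measurable glue := by
    refine measurable_pi_iff.2 fun v => ?_
    by_cases hv : v ∈ Λ'
    · simp only [glue, hv, if_true]; exact measurable_pi_apply v
    · simp only [glue, hv, if_false]; exact measurable_const
  have hglue_in : ∀ σ v, v ∈ Λ' → glue σ v = σ v := fun σ v hv => by
    simp only [glue, hv, if_true]
  have hglue_out : ∀ σ v, v ∉ Λ' → glue σ v = ζ v := fun σ v hv => by
    simp only [glue, hv, if_false]
  -- the cube block
  set A : Finset V := sitesIn cell Λ' Q with hAdef
  have hAΛ' : A ⊆ Λ' := sitesIn_subset (cell := cell) Λ' Q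
  have hAunion : ∀ v w, cell v = cell w → v ∈ A → w ∈ A := sitesIn_cellUnion (cell := cell) hΛ' Q
  have hAcube : ∀ v ∈ A, cdist x (cell v) ≤ 2 * n := fun v hv => (hmemQ _).1 (mem_sitesIn.1 hv).2
  have hxA : ∀ v, cell v = x → v ∈ A := fun v hv =>
    mem_sitesIn.2 ⟨hxΛ v hv, (hmemQ _).2 (by rw [hv, cdist_self]; exact Nat.zero_le _)⟩
  have hg1 : ∀ σ, |g σ| ≤ 1 := fun σ => by rw [abs_of_nonneg (hg01 σ).1]; exact (hg01 σ).2
  -- sites off `A` within `1` of `Q`: frozen or shell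
  have hnearA : ∀ v, v ∉ A → (∃ w ∈ A, cdist (cell w) (cell v) ≤ 1) →
      (v ∉ Λ' ∧ cell v ∉ F) ∨ (v ∈ Λ' ∧ cell v ∈ Y) := by
    intro v hvA ⟨w, hw, hwv⟩
    have hxv : cdist x (cell v) ≤ 2 * n + 1 :=
      (cdist_triangle x (cell w) (cell v)).trans (by have := hAcube w hw; omega)
    by_cases hvΛ : v ∈ Λ'
    · right
      refine ⟨hvΛ, (hmemY _).2 ⟨?_, fun u hu => hΛ' v u hu.symm hvΛ⟩⟩
      have hnotQ : cell v ∉ Q := fun h => hvA (mem_sitesIn.2 ⟨hvΛ, h⟩)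
      rw [hmemQ] at hnotQ
      omega
    · exact Or.inl ⟨hvΛ, hoffF _ (by omega)⟩
  -- the glued inner expectation
  set h : (V → S) → ℝ := fun σ => ∫ τ, g τ ∂(γ A (glue σ)) with hhdef
  have hhm : Measurable h := (DobrushinShlosman.measurable_windowAvg' hγ A hgm').comp hglue_m
  have hh01 : ∀ σ, 0 ≤ h σ ∧ h σ ≤ 1 := fun σ => by
    haveI := hγ.isProbability A (glue σ)
    exact integral_mem_unitInterval hgm' hg01
  have hh1 : ∀ σ, |h σ| ≤ 1 := fun σ => by rw [abs_of_nonneg (hh01 σ).1]; exact (hh01 σ).2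
  -- (h1) resampling the cube: `γ_{Λ'} g = γ_{Λ'} h` under both boundary conditions
  have hstep1 : ∀ η : V → S, (∀ v, v ∉ Λ' → cell v ∉ F → η v = ζ v) →
      ∫ σ, g σ ∂(γ Λ' η) = ∫ σ, h σ ∂(γ Λ' η) := by
    intro η hη
    rw [← kernel_integral_integral_eq_of_subset hγ hAΛ' η hgm' hg1]
    refine integral_congr_ae ?_
    filter_upwards [hγ.proper Λ' η] with σ hσ
    simp only [hhdef]
    refine kernel_integral_eq_of_hasBlockLeak_zero_of_abs_le hγ hBL A hAunion σ (glue σ)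
      (fun v hvA hnear => ?_) hgm' hg1 (hgdep.mono fun v hv => Or.inl (hxA v hv))
    rcases hnearA v hvA hnear with ⟨hvΛ, hvF⟩ | ⟨hvΛ, -⟩
    · rw [hglue_out σ v hvΛ, hσ v hvΛ, hη v hvΛ hvF]
    · exact (hglue_in σ v hvΛ).symm
  -- (h3) `h` is an observable of the shell
  have hhdep : DependsOn h {v | cell v ∈ Y} := by
    intro σ₁ σ₂ h12
    simp only [hhdef]
    refine kernel_integral_eq_of_hasBlockLeak_zero_of_abs_le hγ hBL A hAunion (glue σ₁) (glue σ₂)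
      (fun v hvA hnear => ?_) hgm' hg1 (hgdep.mono fun v hv => Or.inl (hxA v hv))
    rcases hnearA v hvA hnear with ⟨hvΛ, -⟩ | ⟨hvΛ, hvY⟩
    · rw [hglue_out σ₁ v hvΛ, hglue_out σ₂ v hvΛ]
    · rw [hglue_in σ₁ v hvΛ, hglue_in σ₂ v hvΛ]; exact h12 v hvY
  -- (h4) the finite-size condition: `h` oscillates by at most `ε` on the good-shell event
  set G : Set (V → S) := {σ | ∀ y ∈ Y, σ ∈ good y} with hGdef
  have hGmeas : MeasurableSet G := by
    have : G = ⋂ y ∈ Y, good y := by ext σ; simp [hGdef]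
    rw [this]; exact Finset.measurableSet_biInter Y fun y _ => hgm y
  have hGloc : ∀ σ τ : V → S, (∀ v, cell v ∈ Y → σ v = τ v) → (σ ∈ G ↔ τ ∈ G) := fun σ τ hστ => by
    simp only [hGdef, Set.mem_setOf_eq]
    exact forall₂_congr fun y hy => hgl y σ τ fun v hv => hστ v (hv ▸ hy)
  have hosc : ∀ σ₁ σ₂, σ₁ ∈ G → σ₂ ∈ G → |h σ₁ - h σ₂| ≤ ε := by
    intro σ₁ σ₂ h1 h2
    simp only [hhdef]
    -- modify the second exterior on `A` to agree with the first
    let τ₂ : V → S := fun v => if v ∈ A then glue σ₁ v else glue σ₂ v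
    have hker : γ A τ₂ = γ A (glue σ₂) :=
      DobrushinShlosman.spec_apply_congr hγ A fun v hv => by simp only [τ₂, hv, if_false]
    rw [← hker]
    refine hFS.fs x A hAcube hAunion (glue σ₁) τ₂ (fun v hv => ?_) (fun c' hc' hc'A => ?_) g hgm'
      hg01 hgdep
    · by_cases hvA : v ∈ A
      · simp only [τ₂, hvA, if_true]
      · have hvΛ : v ∉ Λ' := fun hvΛ => hvA (mem_sitesIn.2 ⟨hvΛ, (hmemQ _).2 hv⟩)
        simp only [τ₂, hvA, if_false]
        rw [hglue_out σ₁ v hvΛ, hglue_out σ₂ v hvΛ]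
    · -- cells of the cube-and-shell outside `A`: empty, frozen, or shell cells
      have hτ₂c' : ∀ v, cell v = c' → τ₂ v = glue σ₂ v := fun v hv => by
        simp only [τ₂, hc'A v hv, if_false]
      by_cases hc'Λ : ∀ v, cell v = c' → v ∈ Λ'
      · by_cases hemp : ∀ v, cell v ≠ c'
        · exact ⟨mem_good_of_cell_empty hγ hgl hq1 hUKP c' hemp _,
            mem_good_of_cell_empty hγ hgl hq1 hUKP c' hemp _⟩
        · push Not at hemp
          obtain ⟨v₀, hv₀⟩ := hemp
          have hc'Q : c' ∉ Q := fun h => hc'A v₀ hv₀ (mem_sitesIn.2 ⟨hc'Λ v₀ hv₀, hv₀ ▸ h⟩)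
          have hc'Y : c' ∈ Y := (hmemY _).2 ⟨by rw [hmemQ] at hc'Q; omega, hc'Λ⟩
          have e1 : glue σ₁ ∈ good c' ↔ σ₁ ∈ good c' :=
            hgl c' _ _ fun v hv => hglue_in σ₁ v (hc'Λ v hv)
          have e2 : τ₂ ∈ good c' ↔ σ₂ ∈ good c' :=
            hgl c' _ _ fun v hv => by rw [hτ₂c' v hv, hglue_in σ₂ v (hc'Λ v hv)]
          exact ⟨e1.2 (h1 c' hc'Y), e2.2 (h2 c' hc'Y)⟩
      · push Not at hc'Λ
        obtain ⟨v₀, hv₀c, hv₀⟩ := hc'Λ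
        have hcout : ∀ v, cell v = c' → v ∉ Λ' := fun v hv hvΛ =>
          hv₀ (hΛ' v v₀ (hv.trans hv₀c.symm) hvΛ)
        have hc'F : c' ∉ F := hoffF c' (by omega)
        have hζc' : ζ ∈ good c' := by
          have := (hadm v₀ hv₀ (hv₀c ▸ hc'F)).2.1; rwa [hv₀c] at this
        have e1 : glue σ₁ ∈ good c' ↔ ζ ∈ good c' :=
          hgl c' _ _ fun v hv => hglue_out σ₁ v (hcout v hv)
        have e2 : τ₂ ∈ good c' ↔ ζ ∈ good c' :=
          hgl c' _ _ fun v hv => by rw [hτ₂c' v hv, hglue_out σ₂ v (hcout v hv)]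
        exact ⟨e1.2 hζc', e2.2 hζc'⟩
  -- the constant `c₀`
  obtain ⟨c₀, hc₀0, hc₀1, hc₀⟩ : ∃ c₀ : ℝ, 0 ≤ c₀ ∧ c₀ ≤ 1 ∧ ∀ σ ∈ G, c₀ ≤ h σ ∧ h σ ≤ c₀ + ε := by
    by_cases hG : G.Nonempty
    · obtain ⟨σ₀, hσ₀⟩ := hG
      have hbdd : BddBelow (h '' G) := ⟨0, fun t ⟨σ, _, hσt⟩ => hσt ▸ (hh01 σ).1⟩
      refine ⟨sInf (h '' G), le_csInf ⟨h σ₀, σ₀, hσ₀, rfl⟩ fun t ⟨σ, _, hσt⟩ => hσt ▸ (hh01 σ).1,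
        (csInf_le hbdd ⟨σ₀, hσ₀, rfl⟩).trans (hh01 σ₀).2, fun σ hσ => ⟨csInf_le hbdd ⟨σ, hσ, rfl⟩, ?_⟩⟩
      have : h σ - ε ≤ sInf (h '' G) :=
        le_csInf ⟨h σ₀, σ₀, hσ₀, rfl⟩ fun t ⟨σ', hσ', hσ't⟩ => by
          rw [← hσ't]; have := abs_le.1 (hosc σ σ' hσ hσ'); linarith
      linarith
    · exact ⟨0, le_rfl, zero_le_one, fun σ hσ => absurd ⟨σ, hσ⟩ hG⟩
  -- the pieces of the decomposition
  set Far : Set (V → S) := {σ | ¬ badCluster good 1 Finset.univ Y σ ⊆ U} with hFardef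
  set E : Finset (CoarseIdx μc) → Set (V → S) := fun K => clusterEvent good Y K with hEdef
  have hYshape : ∀ K ∈ 𝒩, IsClusterShape (fun a b : CoarseIdx μc => cdist a b ≤ 1) Y K := fun K hK =>
    (mem_clusterShapes.1 (Finset.mem_filter.1 hK).1).2
  have hEmeas : ∀ K ∈ 𝒩, MeasurableSet (E K) := fun K hK =>
    measurableSet_clusterEvent hgm (hYshape K hK)
  have hFar_eq : Far = ⋃ K ∈ (clusterShapes 1 Finset.univ Y).filter (fun K => ¬ K ⊆ U),
      clusterEvent good Y K := by
    ext σ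
    simp only [hFardef, Set.mem_setOf_eq, Set.mem_iUnion, Finset.mem_filter, clusterEvent,
      exists_prop]
    constructor
    · intro hσ
      exact ⟨_, ⟨badCluster_mem_clusterShapes good 1 Finset.univ Y σ, hσ⟩, rfl⟩
    · rintro ⟨K, ⟨-, hKU⟩, hK⟩
      rwa [hK]
  have hFarmeas : MeasurableSet Far := by
    rw [hFar_eq]
    refine Finset.measurableSet_biUnion _ fun K hK => ?_
    exact measurableSet_clusterEvent hgm (mem_clusterShapes.1 (Finset.mem_filter.1 hK).1).2
  -- pointwise partition of unity off/on the good-shell event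
  have hpart : ∀ σ, G.indicator (1 : (V → S) → ℝ) σ + Far.indicator 1 σ +
      ∑ K ∈ 𝒩, (E K).indicator 1 σ = 1 := by
    intro σ
    set K₀ := badCluster good 1 Finset.univ Y σ with hK₀
    have hG_iff : σ ∈ G ↔ K₀ = ∅ := by
      rw [hK₀, badCluster_eq_empty_iff]
      simp [hGdef]
    by_cases h0 : K₀ = ∅
    · have hσG : σ ∈ G := hG_iff.2 h0
      have hσFar : σ ∉ Far := by simp [hFardef, ← hK₀, h0]
      have hsum : ∑ K ∈ 𝒩, (E K).indicator (1 : (V → S) → ℝ) σ = 0 := by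
        refine Finset.sum_eq_zero fun K hK => ?_
        have hne := (Finset.mem_filter.1 hK).2.1
        have hσK : σ ∉ E K := fun hσK => by
          have : K₀ = K := hσK
          exact hne.ne_empty (this ▸ h0)
        simp [hσK]
      simp [hσG, hσFar, hsum]
    · have hσG : σ ∉ G := fun hσG => h0 (hG_iff.1 hσG)
      by_cases hU' : K₀ ⊆ U
      · have hσFar : σ ∉ Far := by simp [hFardef, ← hK₀, hU']
        have hK₀𝒩 : K₀ ∈ 𝒩 := Finset.mem_filter.2
          ⟨badCluster_mem_clusterShapes good 1 Finset.univ Y σ, Finset.nonempty_iff_ne_empty.2 h0, hU'⟩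
        have hsum : ∑ K ∈ 𝒩, (E K).indicator (1 : (V → S) → ℝ) σ = 1 := by
          rw [Finset.sum_eq_single_of_mem K₀ hK₀𝒩]
          · have : σ ∈ E K₀ := rfl
            simp [this]
          · intro K _ hKK₀
            have hσK : σ ∉ E K := fun hσK => hKK₀ (Eq.symm hσK)
            simp [hσK]
        simp [hσG, hσFar, hsum]
      · have hσFar : σ ∈ Far := hU'
        have hsum : ∑ K ∈ 𝒩, (E K).indicator (1 : (V → S) → ℝ) σ = 0 := by
          refine Finset.sum_eq_zero fun K hK => ?_
          have hKU := (Finset.mem_filter.1 hK).2.2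
          have hσK : σ ∉ E K := fun hσK => by
            have : K₀ = K := hσK
            exact hU' (this ▸ hKU)
          simp [hσK]
        simp [hσG, hσFar, hsum]
  -- integrability helpers
  have hint : ∀ (η : V → S) (T : Set (V → S)), MeasurableSet T →
      Integrable (fun σ => (h σ - c₀) * T.indicator 1 σ) (γ Λ' η) := by
    intro η T hT
    haveI := hγ.isProbability Λ' η
    refine DobrushinMetric.integrable_of_abs_le' ((hhm.sub measurable_const).mul
      (measurable_const.indicator hT)) (M := 1) fun σ => ?_
    rw [abs_mul]
    have h1 : |h σ - c₀| ≤ 1 := by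
      rw [abs_le]; constructor <;> linarith [(hh01 σ).1, (hh01 σ).2, hc₀0, hc₀1]
    have h2 : |T.indicator (1 : (V → S) → ℝ) σ| ≤ 1 := by
      by_cases hσ : σ ∈ T <;> simp [hσ]
    nlinarith [abs_nonneg (h σ - c₀), abs_nonneg (T.indicator (1 : (V → S) → ℝ) σ)]
  -- the decomposition of `∫ h`
  have hdecomp : ∀ η : V → S, ∫ σ, h σ ∂(γ Λ' η) =
      c₀ + ∫ σ, (h σ - c₀) * G.indicator 1 σ ∂(γ Λ' η) +
        ∫ σ, (h σ - c₀) * Far.indicator 1 σ ∂(γ Λ' η) +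
        ∑ K ∈ 𝒩, ∫ σ, (h σ - c₀) * (E K).indicator 1 σ ∂(γ Λ' η) := by
    intro η
    haveI := hγ.isProbability Λ' η
    have hpt : ∀ σ, h σ = c₀ + ((h σ - c₀) * G.indicator 1 σ + (h σ - c₀) * Far.indicator 1 σ +
        ∑ K ∈ 𝒩, (h σ - c₀) * (E K).indicator 1 σ) := fun σ => by
      rw [← Finset.mul_sum]
      have := hpart σ
      linear_combination -(h σ - c₀) * this
    have hI1 := hint η G hGmeas
    have hI2 := hint η Far hFarmeas
    have hI3 : Integrable (fun σ => ∑ K ∈ 𝒩, (h σ - c₀) * (E K).indicator 1 σ) (γ Λ' η) :=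
      integrable_finsetSum 𝒩 fun K hK => hint η (E K) (hEmeas K hK)
    have hI12 : Integrable (fun σ => (h σ - c₀) * G.indicator 1 σ +
        (h σ - c₀) * Far.indicator 1 σ) (γ Λ' η) := hI1.add hI2
    have hI123 : Integrable (fun σ => (h σ - c₀) * G.indicator 1 σ +
        (h σ - c₀) * Far.indicator 1 σ + ∑ K ∈ 𝒩, (h σ - c₀) * (E K).indicator 1 σ) (γ Λ' η) :=
      hI12.add hI3
    have e0 : (fun σ => h σ) = fun σ => c₀ + ((h σ - c₀) * G.indicator 1 σ +
        (h σ - c₀) * Far.indicator 1 σ + ∑ K ∈ 𝒩, (h σ - c₀) * (E K).indicator 1 σ) :=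
      funext hpt
    calc ∫ σ, h σ ∂(γ Λ' η)
        = ∫ σ, c₀ + ((h σ - c₀) * G.indicator 1 σ + (h σ - c₀) * Far.indicator 1 σ +
            ∑ K ∈ 𝒩, (h σ - c₀) * (E K).indicator 1 σ) ∂(γ Λ' η) := by rw [e0]
      _ = c₀ + (∫ σ, (h σ - c₀) * G.indicator 1 σ ∂(γ Λ' η) +
            ∫ σ, (h σ - c₀) * Far.indicator 1 σ ∂(γ Λ' η) +
            ∫ σ, ∑ K ∈ 𝒩, (h σ - c₀) * (E K).indicator 1 σ ∂(γ Λ' η)) := by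
          rw [integral_add (integrable_const c₀) hI123, integral_add hI12 hI3, integral_add hI1 hI2,
            integral_const, probReal_univ, one_smul]
      _ = _ := by
          rw [integral_finsetSum 𝒩 fun K hK => hint η (E K) (hEmeas K hK)]
          ring
  -- (T1) the good-shell term: `ε Σ_{y ∈ Y} δ y`
  have hT1 : |∫ σ, (h σ - c₀) * G.indicator 1 σ ∂(γ Λ' ζ) -
      ∫ σ, (h σ - c₀) * G.indicator 1 σ ∂(γ Λ' ζ')| ≤ ε * ∑ y ∈ Y, δ y := by
    have hYΛ : ∀ y ∈ Y, ∀ v, cell v = y → v ∈ Λ' := fun y hy => ((hmemY y).1 hy).2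
    rcases hε.eq_or_lt with hε0 | hεpos
    · -- `ε = 0`: the integrand vanishes
      have hzero : ∀ σ, (h σ - c₀) * G.indicator (1 : (V → S) → ℝ) σ = 0 := fun σ => by
        by_cases hσ : σ ∈ G
        · have := hc₀ σ hσ; rw [← hε0] at this
          have : h σ - c₀ = 0 := by linarith
          rw [this, zero_mul]
        · simp [hσ]
      simp only [hzero, integral_zero, sub_self, abs_zero, ← hε0, zero_mul, le_refl]
    · set Ht : (V → S) → ℝ := fun σ => (h σ - c₀) * G.indicator 1 σ / ε with hHt
      have hHtm : Measurable Ht :=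
        ((hhm.sub measurable_const).mul (measurable_const.indicator hGmeas)).div_const ε
      have hHt01 : ∀ σ, 0 ≤ Ht σ ∧ Ht σ ≤ 1 := fun σ => by
        by_cases hσ : σ ∈ G
        · have := hc₀ σ hσ
          simp only [hHt, Set.indicator_of_mem hσ, Pi.one_apply, mul_one]
          constructor
          · exact div_nonneg (by linarith) hεpos.le
          · rw [div_le_one hεpos]; linarith
        · simp [hHt, hσ]
      have hHtdep : DependsOn Ht {v | cell v ∈ Y} := fun σ τ hστ => by
        have e1 : h σ = h τ := hhdep hστ
        have e2 : σ ∈ G ↔ τ ∈ G := hGloc σ τ fun v hv => hστ v hv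
        simp only [hHt, e1]
        by_cases hσ : σ ∈ G
        · simp [Set.indicator_of_mem hσ, Set.indicator_of_mem (e2.1 hσ)]
        · simp [Set.indicator_of_notMem hσ, Set.indicator_of_notMem (fun h' => hσ (e2.2 h'))]
      have hHt0 : ∀ σ, (∃ y ∈ Y, σ ∉ good y) → Ht σ = 0 := by
        rintro σ ⟨y, hy, hσy⟩
        have hσ : σ ∉ G := fun hσ => hσy (hσ y hy)
        simp [hHt, hσ]
      have hch := multiCell_influence_adm hγ hgl F hδ hR Y Λ' hΛ' hYΛ Ht hHtm hHt01 hHtdep hHt0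
        ζ ζ' hadm
      have heq : ∀ η, ∫ σ, (h σ - c₀) * G.indicator 1 σ ∂(γ Λ' η) = ε * ∫ σ, Ht σ ∂(γ Λ' η) := by
        intro η
        rw [← integral_const_mul]
        refine integral_congr_ae (ae_of_all _ fun σ => ?_)
        simp only [hHt]
        field_simp
      rw [heq ζ, heq ζ', ← mul_sub, abs_mul, abs_of_pos hεpos]
      exact mul_le_mul_of_nonneg_left hch hεpos.le
  -- (T2) the far term
  have hT2 : |∫ σ, (h σ - c₀) * Far.indicator 1 σ ∂(γ Λ' ζ) -
      ∫ σ, (h σ - c₀) * Far.indicator 1 σ ∂(γ Λ' ζ')| ≤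
      2 * (Y.card * (2 * q * (((3 : ℝ) ^ d + 1) ^ 2 * q) ^ (D - 2 * n - 3))) := by
    have hone : ∀ η : V → S, (∀ v, v ∉ Λ' → cell v ∉ F → η ∈ good (cell v)) →
        |∫ σ, (h σ - c₀) * Far.indicator 1 σ ∂(γ Λ' η)| ≤
          Y.card * (2 * q * (((3 : ℝ) ^ d + 1) ^ 2 * q) ^ (D - 2 * n - 3)) := by
      intro η hη
      haveI := hγ.isProbability Λ' η
      have h1 : |∫ σ, (h σ - c₀) * Far.indicator 1 σ ∂(γ Λ' η)| ≤ (γ Λ' η).real Far := by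
        refine (abs_integral_le_integral_abs).trans ?_
        have hle : ∀ σ, |(h σ - c₀) * Far.indicator (1 : (V → S) → ℝ) σ| ≤ Far.indicator 1 σ := by
          intro σ
          by_cases hσ : σ ∈ Far
          · simp only [Set.indicator_of_mem hσ, Pi.one_apply, mul_one]
            rw [abs_le]; constructor <;> linarith [(hh01 σ).1, (hh01 σ).2, hc₀0, hc₀1]
          · simp [hσ]
        calc ∫ σ, |(h σ - c₀) * Far.indicator 1 σ| ∂(γ Λ' η)
            ≤ ∫ σ, Far.indicator 1 σ ∂(γ Λ' η) :=
              integral_mono (hint η Far hFarmeas).abs ((integrable_const (1 : ℝ)).indicator hFarmeas)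
                hle
          _ = (γ Λ' η).real Far := integral_indicator_one hFarmeas
      refine h1.trans ?_
      refine measureReal_farEvent_le hγ hq hq2 hUKP Λ' hΛ' η U Y (fun c hc => ?_)
        (fun c hc c' hcc' => ?_) (fun s hs t ⟨c, hcU, htc⟩ => ?_)
      · rw [hmemU]; have := ((hmemY c).1 hc).1; omega
      · by_cases hc'Λ : ∀ v, cell v = c' → v ∈ Λ'
        · exact Or.inl hc'Λ
        · right
          push Not at hc'Λ
          obtain ⟨v₀, hv₀c, hv₀⟩ := hc'Λ
          have hc'F : c' ∉ F := hoffF c' (by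
            have h1 := (hmemU c).1 hc
            have h2 : cdist x c' ≤ cdist x c + cdist c c' := cdist_triangle _ _ _
            omega)
          have := hη v₀ hv₀ (hv₀c ▸ hc'F); rwa [hv₀c] at this
      · have hsY := ((hmemY s).1 hs).1
        have hcU' : ¬ cdist x c ≤ D - 2 := fun h => hcU ((hmemU c).2 h)
        have h1 : cdist x c ≤ cdist x s + cdist s c := cdist_triangle _ _ _
        have h2 : cdist s c ≤ cdist s t + cdist t c := cdist_triangle _ _ _
        omega
    have hζg : ∀ v, v ∉ Λ' → cell v ∉ F → ζ ∈ good (cell v) := fun v hv hF => (hadm v hv hF).2.1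
    have hζ'g : ∀ v, v ∉ Λ' → cell v ∉ F → ζ' ∈ good (cell v) := fun v hv hF => (hadm v hv hF).2.2
    calc |∫ σ, (h σ - c₀) * Far.indicator 1 σ ∂(γ Λ' ζ) -
          ∫ σ, (h σ - c₀) * Far.indicator 1 σ ∂(γ Λ' ζ')|
        ≤ |∫ σ, (h σ - c₀) * Far.indicator 1 σ ∂(γ Λ' ζ)| +
            |∫ σ, (h σ - c₀) * Far.indicator 1 σ ∂(γ Λ' ζ')| := abs_sub _ _
      _ ≤ _ := by have := hone ζ hζg; have := hone ζ' hζ'g; linarith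
  -- (T3) the near cluster terms
  have hT3 : ∀ K ∈ 𝒩, |∫ σ, (h σ - c₀) * (E K).indicator 1 σ ∂(γ Λ' ζ) -
      ∫ σ, (h σ - c₀) * (E K).indicator 1 σ ∂(γ Λ' ζ')| ≤ 2 * q ^ K.card * ∑ y ∈ Rg K, δ y := by
    intro K hK
    obtain ⟨hKsh, hKne, hKU⟩ := Finset.mem_filter.1 hK
    have hKshape := (mem_clusterShapes.1 hKsh).2
    have habs : ∀ σ, |h σ - c₀| ≤ 1 := fun σ => by
      rw [abs_le]; constructor <;> linarith [(hh01 σ).1, (hh01 σ).2, hc₀0, hc₀1]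
    have hres := clusterTerm_influence_le hγ hgl hgm hBL hq hUKP F hδ hR Λ' hΛ' ζ ζ' hadm Q Y K
      hKshape (fun c ⟨k, hk, hkc⟩ => ?_) (fun c hc => hoffF c ?_) (fun c hc => ((hmemY c).1 hc).2)
      (fun c hcQ hcK ⟨p, hp, hpc⟩ hcΛ => ?_) (fun σ => h σ - c₀) (hhm.sub measurable_const) habs
      (fun σ τ hστ => by simp only [hhdep hστ])
    · simpa [hRgdef] using hres
    · refine hoffF c ?_
      rcases Finset.mem_union.1 hk with hkQ | hkK
      · have := (hmemQ k).1 hkQ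
        have := cdist_triangle x k c
        omega
      · have := (hmemU k).1 (hKU hkK)
        have := cdist_triangle x k c
        omega
    · have := ((hmemY c).1 hc).1; omega
    · have h1 := (hmemQ p).1 hp
      have h2 : cdist x c ≤ cdist x p + cdist p c := cdist_triangle _ _ _
      have h3 : ¬ cdist x c ≤ 2 * n := fun h => hcQ ((hmemQ c).2 h)
      exact (hmemY c).2 ⟨by omega, hcΛ⟩
  -- assemble
  have hζF : ∀ v, v ∉ Λ' → cell v ∉ F → ζ v = ζ v := fun _ _ _ => rfl
  have hζ'F : ∀ v, v ∉ Λ' → cell v ∉ F → ζ' v = ζ v := fun v hv hF => (hadm v hv hF).1.symm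
  rw [hstep1 ζ hζF, hstep1 ζ' hζ'F, hdecomp ζ, hdecomp ζ']
  have hsum3 : |∑ K ∈ 𝒩, ∫ σ, (h σ - c₀) * (E K).indicator 1 σ ∂(γ Λ' ζ) -
      ∑ K ∈ 𝒩, ∫ σ, (h σ - c₀) * (E K).indicator 1 σ ∂(γ Λ' ζ')| ≤
      ∑ K ∈ 𝒩, 2 * q ^ K.card * ∑ y ∈ Rg K, δ y := by
    rw [← Finset.sum_sub_distrib]
    exact (Finset.abs_sum_le_sum_abs _ _).trans (Finset.sum_le_sum hT3)
  calc |c₀ + ∫ σ, (h σ - c₀) * G.indicator 1 σ ∂(γ Λ' ζ) +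
          ∫ σ, (h σ - c₀) * Far.indicator 1 σ ∂(γ Λ' ζ) +
          ∑ K ∈ 𝒩, ∫ σ, (h σ - c₀) * (E K).indicator 1 σ ∂(γ Λ' ζ) -
        (c₀ + ∫ σ, (h σ - c₀) * G.indicator 1 σ ∂(γ Λ' ζ') +
          ∫ σ, (h σ - c₀) * Far.indicator 1 σ ∂(γ Λ' ζ') +
          ∑ K ∈ 𝒩, ∫ σ, (h σ - c₀) * (E K).indicator 1 σ ∂(γ Λ' ζ'))|
      = |(∫ σ, (h σ - c₀) * G.indicator 1 σ ∂(γ Λ' ζ) -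
            ∫ σ, (h σ - c₀) * G.indicator 1 σ ∂(γ Λ' ζ')) +
          (∫ σ, (h σ - c₀) * Far.indicator 1 σ ∂(γ Λ' ζ) -
            ∫ σ, (h σ - c₀) * Far.indicator 1 σ ∂(γ Λ' ζ')) +
          (∑ K ∈ 𝒩, ∫ σ, (h σ - c₀) * (E K).indicator 1 σ ∂(γ Λ' ζ) -
            ∑ K ∈ 𝒩, ∫ σ, (h σ - c₀) * (E K).indicator 1 σ ∂(γ Λ' ζ'))| := by ring_nf
    _ ≤ |∫ σ, (h σ - c₀) * G.indicator 1 σ ∂(γ Λ' ζ) -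
            ∫ σ, (h σ - c₀) * G.indicator 1 σ ∂(γ Λ' ζ')| +
          |∫ σ, (h σ - c₀) * Far.indicator 1 σ ∂(γ Λ' ζ) -
            ∫ σ, (h σ - c₀) * Far.indicator 1 σ ∂(γ Λ' ζ')| +
          |∑ K ∈ 𝒩, ∫ σ, (h σ - c₀) * (E K).indicator 1 σ ∂(γ Λ' ζ) -
            ∑ K ∈ 𝒩, ∫ σ, (h σ - c₀) * (E K).indicator 1 σ ∂(γ Λ' ζ')| :=
        (abs_add_le _ _).trans (add_le_add (abs_add_le _ _) le_rfl)
    _ ≤ ε * ∑ y ∈ Y, δ y +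
          2 * (Y.card * (2 * q * (((3 : ℝ) ^ d + 1) ^ 2 * q) ^ (D - 2 * n - 3))) +
          ∑ K ∈ 𝒩, 2 * q ^ K.card * ∑ y ∈ Rg K, δ y := add_le_add (add_le_add hT1 hT2) hsum3
    _ = _ := by ring

end Literature.Probability.LatticeModels
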